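import Mathlib
import Summits.Ventures.PercRepro2.Defs
import Summits.Ventures.PercRepro2.Independence
import Summits.Ventures.PercRepro2.Harris
import Summits.Ventures.PercRepro2.Graph
import Summits.Ventures.PercRepro2.Exploration
import Summits.Ventures.PercRepro2.Events
import Summits.Ventures.PercRepro2.FourFunctions
import Summits.Ventures.PercRepro2.Induced
import Summits.Ventures.PercRepro2.Frontier
import Summits.Ventures.PercRepro2.ObsIndependence
import Summits.Ventures.PercRepro2.BHK
import Summits.Ventures.PercRepro2.BHKEvents
import Summits.Ventures.PercRepro2.SideAgreement
import Summits.Ventures.PercRepro2.VdBKahn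
import Summits.Ventures.PercRepro2.BHKAvoid
import Summits.Ventures.PercRepro2.R2PrimeThreeReduction
import Summits.Ventures.PercRepro2.YBridge
import Summits.Ventures.PercRepro2.Yu1Functionals
import Summits.Ventures.PercRepro2.Yu1Events
import Summits.Ventures.PercRepro2.Yu1
import Summits.Ventures.PercRepro2.LBSplit
import Summits.Ventures.PercRepro2.YDelta
import Summits.Ventures.PercRepro2.SD
import Summits.Ventures.PercRepro2.Threshold
import Summits.Ventures.PercRepro2.Lambda
import Summits.Ventures.PercRepro2.LambdaTau
import Summits.Ventures.PercRepro2.LambdaSlack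
import Summits.Ventures.PercRepro2.HF2
import Summits.Ventures.PercRepro2.Yu2
import Summits.Ventures.PercRepro2.N0
import Summits.Ventures.PercRepro2.Y
import Summits.Ventures.PercRepro2.YDeltaTools
import Summits.Ventures.PercRepro2.ZDelta
import Summits.Ventures.PercRepro2.ZExpand
import Summits.Ventures.PercRepro2.ISplit
import Summits.Ventures.PercRepro2.MRl
import Summits.Ventures.PercRepro2.ZOloc
import Summits.Ventures.PercRepro2.SideBridge
import Summits.Ventures.PercRepro2.HCov
import Summits.Ventures.PercRepro2.HullDefs
import Summits.Ventures.PercRepro2.HullFlip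
import Summits.Ventures.PercRepro2.HullTheoremA
import Summits.Ventures.PercRepro2.LocRows

/-!
# (LOC-𝓤)⁺: the swap-symmetric two-sided local injection (blind cell PercRepro2, typer-1; lead g11
11:01:23Z (2) / engine g8 D53 11:06:21Z — Hall holds in two implementations at `n ≤ 6`, all up-sets)

`LocU₂`: an injection `srcU → tgtU` that recolours only edges touching `C_B(l)` of the SOURCE and
only edges touching `C_R(l)` of the IMAGE (`ψ` is `BL`-local, `ψ⁻¹` is `RL(image)`-local);
`locU_of_locU₂`: it is a (LOC-𝓤) injection.
-/

namespace Summit.Ventures.PercRepro2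

namespace LocRows

open Hull

variable {V : Type*} {E : Type*} [Fintype E] [DecidableEq E]

open scoped Classical

variable (ends : E → Sym2 V)

/-- **(LOC-𝓤)⁺** (swap-symmetric two-sided locality): an injection `srcU → tgtU` with
`diff(ζ, ψ ζ) ⊆ E(C_B(l)(ζ)) ∩ E(C_R(l)(ψ ζ))`. -/
def LocU₂ (l h : V) (𝓤 : Set (Set V)) : Prop :=
  ∃ f : {ζ // ζ ∈ srcU ends l h 𝓤} → Config E, Function.Injective f ∧
    ∀ x, f x ∈ tgtU ends l h 𝓤 ∧
      LocalAtSet ends (fun ζ => cluster ends (blue ζ) l) x.1 (f x) ∧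
      LocalAtSet ends (fun ζ => cluster ends ζ l) (f x) x.1

/-- The two-sided injection is in particular a (LOC-𝓤) injection. -/
theorem locU_of_locU₂ (l h : V) (𝓤 : Set (Set V)) (hl : LocU₂ ends l h 𝓤) : LocU ends l h 𝓤 := by
  obtain ⟨f, hf, hmem⟩ := hl
  exact ⟨f, hf, fun x => ⟨(hmem x).1, (hmem x).2.1⟩⟩

end LocRows

end Summit.Ventures.PercRepro2
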